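import Summits.QuantumFields.BalabanUV.T4Continuum.Support.ShellMeasureAverageProp5General
import Summits.QuantumFields.BalabanUV.T4Continuum.Support.ShellMeasureLandauCorrectionB7Flat

/-!
# `T4Continuum.ShellMeasureAverageProp5GeneralRegime` — row S68 (c) companion (rule G-1 spirit): THE REGIME OF «[B7] PROP. 5 AT
# A GENERAL REGULAR BACKGROUND» IS NON-EMPTY — the `α₀`-binders are JOINTLY inhabited, the field binders follow from ONE
# smallness, and the FLAT FACE of (157) holds UNCONDITIONALLY
(cell `pub-balaban`, sub-cell `t4`, spine estimate NE7c (node U5b); NE7c ROUND-2 crew, unit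
`b2b-balaban-t4-ne7c-formalise-leaf-10` gen 11; owner table `t4/b2b-balaban-t4-ne7c-p1/LEAVES-NE7c-P1.md` v3.7 row **S68 (c)**
(this lineage: F1a∕F1b∕F2a∕F2b Literature + F3a `ShellMeasureAverageProp5Levels` p226087 + F3b `ShellMeasureAverageProp5General`
p226997∕p227462), crew rule G-1 (R-ne7cp1-g32-3 (a)(2), l.18261 (d)); ADDITIVE — imports F3b and this lineage's S64 f3
`ShellMeasureLandauCorrectionB7Flat` (`avgClosed_bot`, `pdev_one`, `regime_exists`) ONLY; [folklore]; 0 `def`, 0 `def … : Prop`,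
0 sorry, 0 citation tags)

HONEST FRAMING.  Finite four-torus programme, rung (B)+1 only — NOT infinite volume, NOT a mass gap, NOT the Clay
problem, NOT summit progress; (B), `BetaPertHyp`, (B^μ) not consumed.  NE7c (`T4IndicatorShell.ShellWeightBound`) is NOT
PRINTED in [Balaban 1983–89] and NOT PROVED; «NE7c ⇐ the named binders» (trigger c3, WALL `t4/b2b-balaban-t4-ne7c-p1/WALL-NE7c-P1.md`
§2b).  This file is ARITHMETIC + ONE CALL of F3b: it certifies that the hypothesis list of `prop5_general_157` ∕ `_156` is
consistent (not vacuous by contradiction among its numeric binders) and records the flat face.  B7-level bookkeeping on OUR side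
of WALL §2 (a) (W-a (Cf′)); nothing of Bałaban's live-level estimates is discharged; [Balaban1985Averaging] (145)∕(155)∕(157)
LOCATE shapes only.  HONEST DEPENDENCY (cell): continuum YM on T⁴ ⇐ BetaPertH ∧ nine spine estimates (0/9 proved); BetaPertH
⇐ (D1) ∧ (D4) ∧ CAP+tail; G-an2-4 gates asym, D1 and NE2/3/4.

THE POINT.  F3b's `prop5_general_157` takes, besides the structural data (`L ≥ 2`, an averaging-closed structure group `G`, a
`G`-valued background `U₀` with «(52)» `pdev U₀ < α₀L^{−2k}`), the NUMERIC binders `0 < α₀`, `C₀α₀ ≤ 1∕3`, `4α₀ ≤ c₂′`, the field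
size `‖B‖ ≤ b`, print's bracket `hsmall : e^{4·O1cov·α₀}(1 + 8C1cov·Lᵏb) ≤ 2`, `hc₃ : 8Lᵏb < c₃`, and the two displayed
inequalities `h145`, `h155`.  F3b's `smallness_sufficient` already reduces `h145 ∧ h155` to `2dθ ≤ L³∕16` (`θ = thetaCov d L α₀`) and
`2d·C3cov·(Lᵏb) ≤ 1`.  Here:
* §1 **`alpha_regime_exists`**: for every `d` and `L ≥ 1` ONE `α₀ > 0` meets ALL FOUR `α₀`-conditions at once (`C₀α₀ ≤ 1∕3`,
  `4α₀ ≤ c₂′`, `4·O1cov·α₀ ≤ 1∕3`, `2d·thetaCov d L α₀ ≤ L³∕16`);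
* §2 **`field_regime_of_smallness`**: for `d ≥ 1`, `L ≥ 2` the ONE field smallness `2d·C3cov(d,L)·t ≤ 1` (`t = Lᵏb`) implies the
  bracket's `8C1cov·t ≤ 1∕3` and `8t < c₃(d,L)` (because `C3cov = 64·C1cov·L^{d+2}` dwarfs both);
* §3 **`prop5_general_157_simple`**: F3b's (157) with the numeric binders REPLACED by `4·O1cov·α₀ ≤ 1∕3`, `2dθ ≤ L³∕16`,
  `2d·C3cov·Lᵏb ≤ 1` (ONE CALL of `prop5_general_157` after `smallness_of_bracket` ∕ `smallness_sufficient` ∕ §2);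
* §4 **`prop5_general_157_flat`** — THE FLAT FACE, UNCONDITIONAL: at `U₀ = 1` (structure group `{1}`, `pdev 1 = 0`), for EVERY
  `d ≥ 1`, `L ≥ 2`, `k`, and every field with `2d·C3cov(d,L)·(Lᵏ·sup‖B‖) ≤ 1`, (157) holds per bond with NO further hypothesis
  (`α₀` from §1 is eliminated — the conclusion does not mention it);
* §5 a CONCRETE instance (`𝔸 = ℂ`, `d = 1`, `L = 2`, any `k`, the zero field): the END fires — rule G-1's joint-inhabitation
  `example` for this row's numeric∕structural binder family.
NOTHING in the countdown moves; NE7c NOT PROVED; spine PROVED 0∕9.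
-/

noncomputable section

open scoped BigOperators
open NormedSpace Finset Metric

namespace Summit.QuantumFields.BalabanUV.T4Continuum.ShellMeasureAverageProp5GeneralRegime

open Literature.MathematicalPhysics.QuantumFieldTheory.Balaban1983to89
open B7Prop1Explicit B7Prop2Explicit B7Prop3Flat B7Prop5GeneralInduction
open B7Prop5Flat (BondIn bump)
open Summit.QuantumFields.BalabanUV.T4Continuum.ShellMeasureAverageProp4General (C1cov O1cov C1cov_pos O1cov_pos
  smallness_of_bracket)
open B7Prop1Local (loK bondHiK)
open Summit.QuantumFields.BalabanUV.T4Continuum.ShellMeasureAverageProp5Levels (thetaCov C1ppCov C3cov thetaCov_nonneg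
  C1ppCov_pos C3cov_pos)
open Summit.QuantumFields.BalabanUV.T4Continuum.ShellMeasureAverageProp5General (prop5_general_157 smallness_sufficient)
open Summit.QuantumFields.BalabanUV.T4Continuum.ShellMeasureLandauCorrectionB7Flat (avgClosed_bot pdev_one regime_exists)

export B7Prop1Explicit (Site)

/-! ## §1 The `α₀`-binders are jointly inhabited -/

/-- **ONE `α₀ > 0` MEETS EVERY `α₀`-CONDITION OF THE ROW**: `C₀(d)α₀ ≤ 1∕3` (Prop. 2), `4α₀ ≤ c₂′(d,L)`, print's bracket
`4·O1cov(d)·α₀ ≤ 1∕3`, and the (145)∕(155)-smallness `2d·thetaCov(d,L,α₀) ≤ L³∕16` — for every `d` and `L ≥ 1`. [folklore] -/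
theorem alpha_regime_exists (d : ℕ) {L : ℕ} (hL : 1 ≤ L) :
    ∃ α₀ : ℝ, 0 < α₀ ∧ C0 d * α₀ ≤ 1 / 3 ∧ 4 * α₀ ≤ c2' d L ∧ 4 * O1cov d * α₀ ≤ 1 / 3 ∧
      2 * d * thetaCov d L α₀ ≤ (L : ℝ) ^ 3 / 16 := by
  obtain ⟨α₁, hα₁, h1, h2, h3⟩ := regime_exists d hL
  have hL0 : (0 : ℝ) < L := by exact_mod_cast hL
  -- the (145)/(155) ceiling: `2d·3200(d+1)(d+4)L^{d+1}·α₀ ≤ L³/16`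
  set c : ℝ := 2 * d * (3200 * ((d : ℝ) + 1) * ((d : ℝ) + 4) * (L : ℝ) ^ (d + 1)) + 1 with hc
  have hc0 : 0 < c := by rw [hc]; positivity
  set α₂ : ℝ := (L : ℝ) ^ 3 / 16 / c with hα₂
  have hα₂0 : 0 < α₂ := by rw [hα₂]; positivity
  refine ⟨min α₁ α₂, lt_min hα₁ hα₂0, ?_, ?_, ?_, ?_⟩
  · exact (mul_le_mul_of_nonneg_left (min_le_left _ _) (C0_pos d).le).trans h1
  · linarith [min_le_left α₁ α₂]
  · exact (mul_le_mul_of_nonneg_left (min_le_left _ _) (by have := O1cov_pos d; positivity)).trans h3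
  · have hmin : min α₁ α₂ ≤ α₂ := min_le_right _ _
    have hmin0 : 0 ≤ min α₁ α₂ := (lt_min hα₁ hα₂0).le
    have key : 2 * d * thetaCov d L (min α₁ α₂) ≤ c * min α₁ α₂ := by
      unfold thetaCov
      have : 2 * (d : ℝ) * (3200 * ((d : ℝ) + 1) * ((d : ℝ) + 4) * (L : ℝ) ^ (d + 1) * min α₁ α₂)
          = (c - 1) * min α₁ α₂ := by rw [hc]; ring
      rw [this]
      nlinarith
    calc 2 * d * thetaCov d L (min α₁ α₂) ≤ c * min α₁ α₂ := key
      _ ≤ c * α₂ := mul_le_mul_of_nonneg_left hmin hc0.le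
      _ = (L : ℝ) ^ 3 / 16 := by rw [hα₂]; field_simp

/-! ## §2 The field binders from ONE smallness -/

/-- **THE FIELD REGIME FROM ONE SMALLNESS**: for `d ≥ 1`, `L ≥ 2`, `0 ≤ t` and `2d·C3cov(d,L)·t ≤ 1`: the bracket's
`8·C1cov(d)·t ≤ 1∕3` and `8t < c₃(d,L)` (`C3cov = 64·C1cov·L^{d+2}`, `C1cov = 131072(d+1)²`, `c₃ = 1∕(128(d+1)L)`). [folklore] -/
theorem field_regime_of_smallness {d L : ℕ} (hd : 1 ≤ d) (hL : 2 ≤ L) {t : ℝ} (ht : 0 ≤ t)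
    (h : 2 * d * C3cov d L * t ≤ 1) : 8 * C1cov d * t ≤ 1 / 3 ∧ 8 * t < c3 d L := by
  have hd1 : (1 : ℝ) ≤ d := by exact_mod_cast hd
  have hL2 : (2 : ℝ) ≤ L := by exact_mod_cast hL
  have hL1 : (1 : ℝ) ≤ L := by linarith
  have hLp : (L : ℝ) ≤ (L : ℝ) ^ (d + 2) := by
    calc (L : ℝ) = (L : ℝ) ^ 1 := (pow_one _).symm
      _ ≤ (L : ℝ) ^ (d + 2) := pow_le_pow_right₀ hL1 (by omega)
  have hLp1 : (1 : ℝ) ≤ (L : ℝ) ^ (d + 2) := hL1.trans hLp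
  have hC1 : 0 < C1cov d := C1cov_pos d
  have hC1' : (131072 : ℝ) ≤ C1cov d := by
    unfold C1cov; nlinarith
  -- `C3cov = 64·C1cov·L^{d+2}`
  have hC3 : C3cov d L = 64 * C1cov d * (L : ℝ) ^ (d + 2) := by
    simp only [C3cov, C1ppCov]; ring
  refine ⟨?_, ?_⟩
  · -- `128·d·L^{d+2}·(C1cov·t) = 2d·C3cov·t ≤ 1`, and `128·d·L^{d+2} ≥ 128`
    have h5 : 128 * d * (L : ℝ) ^ (d + 2) * (C1cov d * t) ≤ 1 := by
      calc 128 * d * (L : ℝ) ^ (d + 2) * (C1cov d * t) = 2 * d * C3cov d L * t := by rw [hC3]; ring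
        _ ≤ 1 := h
    have hY0 : 0 ≤ C1cov d * t := by positivity
    have h6 : 128 * (C1cov d * t) ≤ 1 := by
      calc 128 * (C1cov d * t) = 128 * 1 * 1 * (C1cov d * t) := by ring
        _ ≤ 128 * d * (L : ℝ) ^ (d + 2) * (C1cov d * t) := by gcongr
        _ ≤ 1 := h5
    have : 8 * C1cov d * t = 8 * (C1cov d * t) := by ring
    rw [this]; linarith
  · -- `16777216·d·(L·t) ≤ 2d·C3cov·t ≤ 1` and `1024(d+1) ≤ 2048 d`
    have hC3ge : 64 * 131072 * (L : ℝ) ≤ C3cov d L := by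
      rw [hC3]
      calc 64 * 131072 * (L : ℝ) = 64 * (131072 * (L : ℝ)) := by ring
        _ ≤ 64 * (C1cov d * (L : ℝ) ^ (d + 2)) := by gcongr
        _ = 64 * C1cov d * (L : ℝ) ^ (d + 2) := by ring
    have hX0 : 0 ≤ (L : ℝ) * t := by positivity
    have h3 : 16777216 * d * ((L : ℝ) * t) ≤ 1 := by
      calc 16777216 * d * ((L : ℝ) * t) = 2 * d * (64 * 131072 * (L : ℝ)) * t := by ring
        _ ≤ 2 * d * C3cov d L * t := by gcongr
        _ ≤ 1 := h
    have h4 : (d : ℝ) + 1 ≤ 2 * d := by linarith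
    rw [c3, lt_div_iff₀ (by positivity)]
    calc 8 * t * (128 * ((d : ℝ) + 1) * L) = 1024 * ((d : ℝ) + 1) * ((L : ℝ) * t) := by ring
      _ ≤ 1024 * (2 * d) * ((L : ℝ) * t) := by gcongr
      _ = 2048 / 16777216 * (16777216 * d * ((L : ℝ) * t)) := by ring
      _ ≤ 2048 / 16777216 * 1 := by gcongr
      _ < 1 := by norm_num

/-! ## §3 (157) under the simplified regime -/

variable {d : ℕ} {𝔸 : Type*} [NormedRing 𝔸] [NormedAlgebra ℂ 𝔸] [CompleteSpace 𝔸] [NormOneClass 𝔸]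

/-- **PROPOSITION 5 (157) AT A GENERAL BACKGROUND UNDER THE SIMPLIFIED REGIME**: F3b's `prop5_general_157` with its numeric
binders `hsmall`, `hc₃`, `h145`, `h155` REPLACED by `4·O1cov·α₀ ≤ 1∕3`, `2d·thetaCov ≤ L³∕16` and the one field smallness
`2d·C3cov·(Lᵏb) ≤ 1` (`d ≥ 1`) — ONE CALL after `smallness_of_bracket`, `smallness_sufficient`, `field_regime_of_smallness`.
[folklore] -/
theorem prop5_general_157_simple (L : ℕ) (hL : 2 ≤ L) {G : Subgroup 𝔸ˣ} (hG : AvgClosed d L G) (k : ℕ)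
    (U₀ : Site d → Fin d → 𝔸ˣ) (hU₀ : ∀ x κ, U₀ x κ ∈ G) {α₀ : ℝ} (hα : 0 < α₀)
    (hα3 : C0 d * α₀ ≤ 1 / 3) (hα4 : 4 * α₀ ≤ c2' d L) (hα6 : 4 * O1cov d * α₀ ≤ 1 / 3)
    (hθ : 2 * d * thetaCov d L α₀ ≤ (L : ℝ) ^ 3 / 16) (h52 : pdev U₀ < α₀ * (((L : ℝ) ^ k)⁻¹) ^ 2)
    (hd : 1 ≤ d) (B : Site d → Fin d → 𝔸) {b : ℝ} (hb : 0 ≤ b) (hB : ∀ x κ, ‖B x κ‖ ≤ b)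
    (ht : 2 * d * C3cov d L * ((L : ℝ) ^ k * b) ≤ 1)
    (y : Site d) (μ : Fin d) (X : 𝔸) {j : ℕ} (hj : j ≤ k) (z : Site d) (κ : Fin d) :
    HasLineDerivAt ℂ (fun B' => CCovIter L U₀ B' j z κ) (dCov L U₀ B (bump y μ X) j z κ) B (bump y μ X) ∧
      ‖dCov L U₀ B (bump y μ X) j z κ‖ ≤ C3cov d L * ((L : ℝ) ^ j) ^ 2 * (((L : ℝ) ^ j) ^ d)⁻¹ * b * ‖X‖ ∧
      (¬ BondIn (loK L j z) (bondHiK L j z κ) y μ → dCov L U₀ B (bump y μ X) j z κ = 0) := by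
  have ht0 : 0 ≤ (L : ℝ) ^ k * b := by positivity
  obtain ⟨h8, hc₃⟩ := field_regime_of_smallness hd hL ht0 ht
  obtain ⟨-, hsmall⟩ := smallness_of_bracket (d := d) hα hα6 ht0 h8
  have hL2 : (2 : ℝ) ≤ L := by exact_mod_cast hL
  obtain ⟨h145, h155⟩ := smallness_sufficient (C₃ := C3cov d L) hL2 (Nat.cast_nonneg d)
    (thetaCov_nonneg d L hα.le) hθ ht
  exact prop5_general_157 L hL hG k U₀ hU₀ hα hα3 hα4 h52 B hb hB hsmall hc₃ h145 h155 y μ X hj z κ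

/-! ## §4 The flat face, unconditional -/

/-- **PROPOSITION 5 (157) AT THE FLAT BACKGROUND, UNCONDITIONAL IN THE BACKGROUND, k-UNIFORM**: for `d ≥ 1`, `L ≥ 2`, every
`k` and every field `B` with `2d·C3cov(d,L)·(Lᵏ·sup‖B‖) ≤ 1`, at `U₀ = 1`: `B′ ↦ C_j(B′)(c)` has at `B` the directional
derivative `dC_j(B; Xδ_b)(c)` in the direction `X·δ_b`, of norm `≤ C3cov·(Lʲ)²·L^{−jd}·b·‖X‖`, vanishing unless
`b ⊂ Bʲ(c₋) ∪ Bʲ(c₊)` — §3 at the trivial structure group `{1}` (`avgClosed_bot`, `pdev_one`) with the `α₀` of §1 (which the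
conclusion does not mention). [folklore] -/
theorem prop5_general_157_flat (hd : 1 ≤ d) (L : ℕ) (hL : 2 ≤ L) (k : ℕ) (B : Site d → Fin d → 𝔸) {b : ℝ} (hb : 0 ≤ b)
    (hB : ∀ x κ, ‖B x κ‖ ≤ b) (ht : 2 * d * C3cov d L * ((L : ℝ) ^ k * b) ≤ 1)
    (y : Site d) (μ : Fin d) (X : 𝔸) {j : ℕ} (hj : j ≤ k) (z : Site d) (κ : Fin d) :
    HasLineDerivAt ℂ (fun B' => CCovIter L (1 : Site d → Fin d → 𝔸ˣ) B' j z κ)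
        (dCov L (1 : Site d → Fin d → 𝔸ˣ) B (bump y μ X) j z κ) B (bump y μ X) ∧
      ‖dCov L (1 : Site d → Fin d → 𝔸ˣ) B (bump y μ X) j z κ‖ ≤
        C3cov d L * ((L : ℝ) ^ j) ^ 2 * (((L : ℝ) ^ j) ^ d)⁻¹ * b * ‖X‖ ∧
      (¬ BondIn (loK L j z) (bondHiK L j z κ) y μ → dCov L (1 : Site d → Fin d → 𝔸ˣ) B (bump y μ X) j z κ = 0) := by
  obtain ⟨α₀, hα, hα3, hα4, hα6, hθ⟩ := alpha_regime_exists d (le_trans (by norm_num) hL : 1 ≤ L)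
  have h52 : pdev (1 : Site d → Fin d → 𝔸ˣ) < α₀ * (((L : ℝ) ^ k)⁻¹) ^ 2 := by
    rw [pdev_one]
    have hL0 : (0 : ℝ) < L := by exact_mod_cast (by omega : 0 < L)
    positivity
  exact prop5_general_157_simple L hL (avgClosed_bot L) k 1 (fun _ _ => Subgroup.one_mem _) hα hα3 hα4 hα6 hθ h52 hd
    B hb hB ht y μ X hj z κ

/-! ## §5 A concrete instance: the END fires (rule G-1 joint inhabitation for this row) -/

/-- **JOINT INHABITATION, CONCRETE**: `𝔸 = ℂ`, `d = 1`, `L = 2`, any `k`, the zero field (`b = 0`): every binder of the row is met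
and (157) holds at every bond — the derivative of `C_j` at `0` in any coordinate direction exists and has norm `≤ 0`. [folklore] -/
example (k : ℕ) (y : Site 1) (μ : Fin 1) (X : ℂ) {j : ℕ} (hj : j ≤ k) (z : Site 1) (κ : Fin 1) :
    HasLineDerivAt ℂ (fun B' => CCovIter 2 (1 : Site 1 → Fin 1 → ℂˣ) B' j z κ)
        (dCov 2 (1 : Site 1 → Fin 1 → ℂˣ) 0 (bump y μ X) j z κ) 0 (bump y μ X) ∧
      ‖dCov 2 (1 : Site 1 → Fin 1 → ℂˣ) 0 (bump y μ X) j z κ‖ ≤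
        C3cov 1 2 * ((2 : ℝ) ^ j) ^ 2 * (((2 : ℝ) ^ j) ^ 1)⁻¹ * 0 * ‖X‖ ∧
      (¬ BondIn (loK 2 j z) (bondHiK 2 j z κ) y μ → dCov 2 (1 : Site 1 → Fin 1 → ℂˣ) 0 (bump y μ X) j z κ = 0) := by
  have h := prop5_general_157_flat (𝔸 := ℂ) (d := 1) le_rfl 2 le_rfl k 0 le_rfl (fun _ _ => by simp)
    (by norm_num) y μ X hj z κ
  simpa only [Nat.cast_ofNat] using h

end Summit.QuantumFields.BalabanUV.T4Continuum.ShellMeasureAverageProp5GeneralRegime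

end
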